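import Mathlib
import Summits.PneNP.PneNP.Theses.OneSlice
import Literature.Computability.Complexity.ClayProblem
import Literature.Computability.Complexity.ClayProblemProofs
import Literature.Computability.Complexity.CircuitClassesUniformProofs

/-!
# Route OneSlice — assembly item `Assembly` (stmt-PneNP-10382)

`Summit.PneNP.PneNP.Theses.OneSlice.Assembly :
  SliceMonotonization → CliqueCircuitsOfNPSubsetPPoly → SliceTarget → PneNP`.

Proof (by contradiction). If `PneNP` fails, every language of Cook's `NP Bool` lies in Cook's
`P Bool`; the PROVED model bridges `NP_bool_eq_holds : PNPWave0.NP Bool = Nondeterministic.NP`,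
`P_bool_eq_holds : PNPWave0.P Bool = Classes.P` and `P_subset_PPoly_holds : Classes.P ⊆ PPoly`
(tree theorems, imported here and used inside the proof) give `Nondeterministic.NP ⊆ PPoly`.
`CliqueCircuitsOfNPSubsetPPoly` then yields an exponent `c₁` such that for every `k`, eventually
in `n`, some `B₂`-circuit of size `≤ n ^ c₁` computes `k`-CLIQUE on the `C(n,2)` edge variables of
`K_n`; `SliceMonotonization` yields `c₀` such that on every proper slice `0 < M < C(n,2)` a
`B₂`-circuit `C` has a monotone `{∧₂,∨₂}`-circuit of size `≤ c₀ (|C| + n ^ c₀)` agreeing with it on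
the slice. Apply `SliceTarget` with `c := c₀ + c₁ + 1`, obtaining `k ≥ 3` and `δ > 0`; at the
central edge count `j := M := ⌊C(n,2) · n ^ (-2/(k-1))⌋₊` (which satisfies `|j - M| = 0 ≤ M ^ (3/4)`
and, because `k ≥ 3`, `0 < M < C(n,2)` for `n ≥ 3`) the monotonized clique circuit is EXACT on the
slice, so its error set is empty (`0 ≤ δ · #slice`) and `SliceTarget` gives
`n ^ c < size ≤ c₀ (n ^ c₁ + n ^ c₀) ≤ n ^ c` for `n ≥ 2 c₀ + 1` — a contradiction on the
intersection of four eventually-true sets of `Filter.atTop`.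

No literature fact is assumed: the three bridges are proved tree theorems (standard axioms).
-/

namespace Summit.PneNP.PneNP.Theorems

open Summit.PneNP.PneNP.Theses.OneSlice
open Literature.Computability.Complexity

/-- From the failure of `PneNP` (Cook's `∃ L ∈ NP Bool, L ∉ P Bool`) to `NP ⊆ P/poly` in the tree's
machine-based classes, through the proved model bridges `NP_bool_eq_holds`, `P_bool_eq_holds` and
`P ⊆ P/poly` (`P_subset_PPoly_holds`, Arora–Barak Thm. 6.6). -/
theorem oneSlice_NP_subset_PPoly_of_not_pneNP (h : ¬ _root_.PneNP) :
    Nondeterministic.NP ⊆ PPoly := by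
  intro L hL
  have eNP : PNPWave0.NP Bool = Nondeterministic.NP := NP_bool_eq_holds
  have eP : PNPWave0.P Bool = Classes.P := P_bool_eq_holds
  have hNP : L ∈ PNPWave0.NP Bool := by
    rw [eNP]
    exact hL
  have hP : L ∈ PNPWave0.P Bool := by
    by_contra hP
    exact h ⟨L, hNP, hP⟩
  rw [eP] at hP
  exact P_subset_PPoly_holds hP

/-- The `k`-clique threshold edge count `M = ⌊C(n,2) · n ^ (-2/(k-1))⌋₊` is a PROPER slice,
`0 < M < C(n,2)`, for every `n ≥ 3` once `k ≥ 3` (then `-1 ≤ -2/(k-1) < 0`, so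
`C(n,2) · n ^ (-2/(k-1)) ≥ C(n,2)/n = (n-1)/2 ≥ 1` and `< C(n,2)`). -/
theorem oneSlice_threshold_pos_lt {k : ℕ} (hk : 3 ≤ k) :
    ∀ᶠ n : ℕ in Filter.atTop,
      0 < ⌊((n.choose 2 : ℕ) : ℝ) * (n : ℝ) ^ (-(2 : ℝ) / ((k : ℝ) - 1))⌋₊ ∧
        ⌊((n.choose 2 : ℕ) : ℝ) * (n : ℝ) ^ (-(2 : ℝ) / ((k : ℝ) - 1))⌋₊ < n.choose 2 := by
  filter_upwards [Filter.eventually_ge_atTop 3] with n hn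
  have hn1 : (1 : ℝ) < n := by exact_mod_cast (by omega : 1 < n)
  have hk3 : (3 : ℝ) ≤ k := by exact_mod_cast hk
  have hkpos : (0 : ℝ) < (k : ℝ) - 1 := by linarith
  have he_neg : -(2 : ℝ) / ((k : ℝ) - 1) < 0 := div_neg_of_neg_of_pos (by norm_num) hkpos
  have he_ge : (-1 : ℝ) ≤ -(2 : ℝ) / ((k : ℝ) - 1) := by
    rw [le_div_iff₀ hkpos]
    linarith
  have hchoose_pos : (0 : ℝ) < ((n.choose 2 : ℕ) : ℝ) := by
    exact_mod_cast Nat.choose_pos (by omega)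
  constructor
  · rw [Nat.floor_pos]
    have h1 : (n : ℝ)⁻¹ ≤ (n : ℝ) ^ (-(2 : ℝ) / ((k : ℝ) - 1)) := by
      rw [← Real.rpow_neg_one]
      exact Real.rpow_le_rpow_of_exponent_le hn1.le he_ge
    have h2 : (n : ℝ) ≤ ((n.choose 2 : ℕ) : ℝ) := by
      have h2' : n ≤ n.choose 2 := by
        rw [Nat.choose_two_right]
        exact (Nat.le_div_iff_mul_le (by norm_num)).mpr (Nat.mul_le_mul_left n (by omega))
      exact_mod_cast h2'
    have hn0 : (n : ℝ) ≠ 0 := by positivity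
    calc (1 : ℝ) = (n : ℝ) * (n : ℝ)⁻¹ := (mul_inv_cancel₀ hn0).symm
      _ ≤ ((n.choose 2 : ℕ) : ℝ) * (n : ℝ) ^ (-(2 : ℝ) / ((k : ℝ) - 1)) :=
        mul_le_mul h2 h1 (by positivity) (by positivity)
  · rw [Nat.floor_lt (by positivity)]
    calc ((n.choose 2 : ℕ) : ℝ) * (n : ℝ) ^ (-(2 : ℝ) / ((k : ℝ) - 1))
        < ((n.choose 2 : ℕ) : ℝ) * 1 :=
          mul_lt_mul_of_pos_left (Real.rpow_lt_one_of_one_lt_of_neg hn1 he_neg) hchoose_pos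
      _ = ((n.choose 2 : ℕ) : ℝ) := mul_one _

/-- Polynomial bookkeeping: `c₀ (n ^ c₁ + n ^ c₀) ≤ n ^ (c₀ + c₁ + 1)` for all `n ≥ 2 c₀ + 1`. -/
theorem oneSlice_size_bound (c₀ c₁ : ℕ) :
    ∀ᶠ n : ℕ in Filter.atTop, c₀ * (n ^ c₁ + n ^ c₀) ≤ n ^ (c₀ + c₁ + 1) := by
  filter_upwards [Filter.eventually_ge_atTop (2 * c₀ + 1)] with n hn
  have hn1 : 1 ≤ n := by omega
  have h1 : n ^ c₁ ≤ n ^ (c₀ + c₁) := Nat.pow_le_pow_right hn1 (by omega)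
  have h2 : n ^ c₀ ≤ n ^ (c₀ + c₁) := Nat.pow_le_pow_right hn1 (by omega)
  have h3 : 2 * c₀ ≤ n := by omega
  calc c₀ * (n ^ c₁ + n ^ c₀) ≤ c₀ * (n ^ (c₀ + c₁) + n ^ (c₀ + c₁)) :=
        Nat.mul_le_mul_left _ (Nat.add_le_add h1 h2)
    _ = (2 * c₀) * n ^ (c₀ + c₁) := by ring
    _ ≤ n * n ^ (c₀ + c₁) := Nat.mul_le_mul_right _ h3
    _ = n ^ (c₀ + c₁ + 1) := by ring

/-- **`Assembly` (stmt-PneNP-10382).** `SliceMonotonization → CliqueCircuitsOfNPSubsetPPoly →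
SliceTarget → PneNP`: by contradiction, `¬PneNP` gives `NP ⊆ P/poly` (proved model bridges),
hence polynomial-size `B₂`-circuits for every `k`-CLIQUE (`CliqueCircuitsOfNPSubsetPPoly`), hence —
by Berkowitz monotonization on the threshold slice `M = ⌊C(n,2) · n ^ (-2/(k-1))⌋₊`
(`SliceMonotonization`) — monotone circuits of size `≤ c₀ (n ^ c₁ + n ^ c₀)` that are exact on the
slice; `SliceTarget` at `c = c₀ + c₁ + 1`, `j = M` forces `n ^ c <` their size, impossible for
large `n`. -/
theorem oneSlice_assembly_proof : Summit.PneNP.PneNP.Theses.OneSlice.Assembly := by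
  unfold Assembly
  intro hMono hClique hTarget
  by_contra hPNP
  obtain ⟨c₁, hc₁⟩ := hClique (oneSlice_NP_subset_PPoly_of_not_pneNP hPNP)
  obtain ⟨c₀, hc₀⟩ := hMono
  obtain ⟨k, hk, δ, hδ, hev⟩ := hTarget (c₀ + c₁ + 1)
  obtain ⟨n, hT, hC, ⟨hMpos, hMlt⟩, hsize⟩ :=
    (hev.and ((hc₁ k).and ((oneSlice_threshold_pos_lt hk).and (oneSlice_size_bound c₀ c₁)))).exists
  obtain ⟨C, hCB2, hCcomp, hCsize⟩ := hC
  set M : ℕ := ⌊((n.choose 2 : ℕ) : ℝ) * (n : ℝ) ^ (-(2 : ℝ) / ((k : ℝ) - 1))⌋₊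
  obtain ⟨C', hC'mono, hC'size, hC'eval⟩ := hc₀ n M C hCB2 hMpos hMlt
  have hcentral : |(M : ℝ) - (M : ℝ)| ≤ (M : ℝ) ^ ((3 : ℝ) / 4) := by
    rw [sub_self, abs_zero]
    exact Real.rpow_nonneg (Nat.cast_nonneg _) _
  -- the monotonized clique circuit is exact on the slice `M`: its error set there is empty
  have hlt : n ^ (c₀ + c₁ + 1) < C'.size := by
    refine hT M hcentral C' hC'mono (Eq.trans_le ?_ (mul_nonneg hδ.le (Nat.cast_nonneg _)))
    rw [Nat.cast_eq_zero, Finset.card_eq_zero, Finset.filter_eq_empty_iff]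
    rintro x - ⟨hx, hne⟩
    exact hne ((hC'eval x hx).trans (hCcomp x))
  have habs : n ^ (c₀ + c₁ + 1) < n ^ (c₀ + c₁ + 1) :=
    calc n ^ (c₀ + c₁ + 1) < C'.size := hlt
      _ ≤ c₀ * (C.size + n ^ c₀) := hC'size
      _ ≤ c₀ * (n ^ c₁ + n ^ c₀) := Nat.mul_le_mul_left _ (Nat.add_le_add_right hCsize _)
      _ ≤ n ^ (c₀ + c₁ + 1) := hsize
  exact lt_irrefl _ habs

end Summit.PneNP.PneNP.Theorems
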